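import Summits.Ventures.PercRepro.GenQSolidPlaneCount

/-!
# PercRepro — the rank-`4` quadruples of a solid, counted through its planes (night-4, gen 5)

The row (S6q) of the `t = 5` TRACE LP of the `(8, 6)` cell (sheet §57) — `Σ_s κ₄(s)·N4 s ≤ C(n, 4)` — needs, for a
solid `F` with `s` points of `G`, at least `κ₄(s) = 4, 20, 50, 100` (`s = 7, 8, 9, 10`) four-subsets of `F ∩ G` of
rank `4`.  Every `4`-subset of `F ∩ G` has rank `3` or `4` (lines `≤ 3` points), and the rank-`3` ones lie in the
planes of `F`: `15` per `6`-point plane, `5` per `5`-point plane, `1` per `4`-point plane.  The planes are paid for by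
the rank-`3` triples of `F ∩ G` (each in exactly one plane; `GenQSolidTriples`): `16·p₆ + 7·p₅ + 3·p₄ ≤ C(s, 3)`, and
the integer knapsack gives `15·p₆ + 5·p₅ + p₄ ≤ 31, 50, 76, 110` at `s = 7, 8, 9, 10`.  Each rank-`4` quadruple of `G`
lies in exactly one solid (`card_rank_eq_eq_sum_flats`), whence the row.

* `card_rank_three_fours_le`: `#{A ⊆ X : |A| = 4, rk A = 3} ≤ Σ_{P ∈ flatsQ M 3} C(|P ∩ X|, 4)`;
* `kappa4'` and `sum_planes_choose_four_le`: `Σ_P C(|P ∩ X|, 4) ≤ κ₄'(|X|)` with `κ₄'(7, 8, 9, 10) = 31, 50, 76, 110`;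
* `choose_four_le_rank_four_add_three`: a `4`-subset of a solid has rank `3` or `4`;
* `kappa4` and `card_rank_four_fours_ge`: `κ₄(|F ∩ G|) ≤ #{A ⊆ F ∩ G : |A| = 4, rk A = 4}`;
* `sum_solids_kappa4_eq` and **`sum_solids_kappa4_le`**: the row (S6q) — `Σ_s κ₄(s)·N4 s ≤ C(|G|, 4)`.

The same template as `GenQSolidPlaneCount` (the `5`-subsets), one size down.  Imports `GenQSolidPlaneCount`.
-/
namespace PercRepro.Night4

open Finset ThmH SixFour GenQ PerFlat Star

variable {α : Type*} [DecidableEq α] {M : Matroid α} [M.Finite]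

/-! ## The rank-`3` quadruples of a set lie in its planes -/

/-- `#{A ⊆ X : |A| = 4, rk A = 3} ≤ Σ_{P ∈ flatsQ M 3} C(|P ∩ X|, 4)`. -/
theorem card_rank_three_fours_le {X : Finset α} (hX : X ⊆ gr M) :
    ((X.powersetCard 4).filter (fun A : Finset α => M.eRk (A : Set α) = ((3 : ℕ) : ℕ∞))).card ≤
      ∑ P ∈ flatsQ M 3, (P ∩ X).card.choose 4 := by
  rw [card_rank_eq_eq_sum_flats hX 4 3]
  apply Finset.sum_le_sum
  intro P _
  rw [← Finset.card_powersetCard]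
  exact Finset.card_filter_le _ _

/-- `κ₄'(s)`: the integer knapsack `max 15a + 5b + c` subject to `16a + 7b + 3c ≤ C(s, 3)` — `31, 50, 76, 110` at
`s = 7, 8, 9, 10`. -/
def kappa4' (s : ℕ) : ℕ :=
  if s = 7 then 31 else if s = 8 then 50 else if s = 9 then 76 else if s = 10 then 110 else s.choose 4

/-- **`Σ_{P ∈ flatsQ M 3} C(|P ∩ X|, 4) ≤ κ₄'(|X|)`** when lines have `≤ 3` and planes `≤ 6` points of `X`
(`|X| ∈ {7, 8, 9, 10}`; trivial otherwise). -/
theorem sum_planes_choose_four_le (hs : Simple M) (hline : ∀ L ∈ flatsQ M 2, L.card ≤ 3)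
    (hplane : ∀ P ∈ flatsQ M 3, P.card ≤ 6) {X : Finset α} (hX : X ⊆ gr M) (hs7 : 7 ≤ X.card)
    (hs10 : X.card ≤ 10) : ∑ P ∈ flatsQ M 3, (P ∩ X).card.choose 4 ≤ kappa4' X.card := by
  set a := ((flatsQ M 3).filter (fun P : Finset α => (P ∩ X).card = 6)).card with ha
  set b := ((flatsQ M 3).filter (fun P : Finset α => (P ∩ X).card = 5)).card with hb
  set c := ((flatsQ M 3).filter (fun P : Finset α => (P ∩ X).card = 4)).card with hc
  -- the sum is `15a + 5b + c`: every plane meets `X` in `≤ 6` points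
  have hp6 : ∀ P ∈ flatsQ M 3, (P ∩ X).card ≤ 6 :=
    fun P hP => (Finset.card_le_card Finset.inter_subset_left).trans (hplane P hP)
  have hsum : ∑ P ∈ flatsQ M 3, (P ∩ X).card.choose 4 = 15 * a + 5 * b + c := by
    have h6 : ∀ P ∈ flatsQ M 3, (P ∩ X).card.choose 4 =
        15 * (if (P ∩ X).card = 6 then 1 else 0) + 5 * (if (P ∩ X).card = 5 then 1 else 0) +
          (if (P ∩ X).card = 4 then 1 else 0) := by
      intro P hP
      have := hp6 P hP
      interval_cases h : (P ∩ X).card <;> decide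
    rw [Finset.sum_congr rfl h6, Finset.sum_add_distrib, Finset.sum_add_distrib, ← Finset.mul_sum,
      ← Finset.mul_sum]
    rw [ha, hb, hc, Finset.card_filter, Finset.card_filter, Finset.card_filter]
  -- the triples: `16a + 7b + 3c ≤ C(|X|, 3)`
  have htr : 16 * a + 7 * b + 3 * c ≤ X.card.choose 3 := by
    have hge : ∀ P ∈ flatsQ M 3, 16 * (if (P ∩ X).card = 6 then 1 else 0) +
        7 * (if (P ∩ X).card = 5 then 1 else 0) + 3 * (if (P ∩ X).card = 4 then 1 else 0) ≤
        (((P ∩ X).powersetCard 3).filter (fun T : Finset α => M.eRk (T : Set α) = ((3 : ℕ) : ℕ∞))).card := by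
      intro P hP
      have hPX : P ∩ X ⊆ gr M := Finset.inter_subset_right.trans hX
      have h := card_rank_three_triples_ge hs hline hPX
      by_cases h6 : (P ∩ X).card = 6
      · simp only [h6, if_true, show (6 : ℕ) ≠ 5 by norm_num, show (6 : ℕ) ≠ 4 by norm_num, if_false]
        have := h.1 h6
        norm_num at this ⊢
        exact this
      · by_cases h5 : (P ∩ X).card = 5
        · simp only [h5, if_true, show (5 : ℕ) ≠ 6 by norm_num, show (5 : ℕ) ≠ 4 by norm_num, if_false]
          have := h.2.1 h5
          norm_num at this ⊢
          exact this
        · by_cases h4 : (P ∩ X).card = 4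
          · simp only [h4, if_true, show (4 : ℕ) ≠ 6 by norm_num, show (4 : ℕ) ≠ 5 by norm_num, if_false]
            have := h.2.2 h4
            norm_num at this ⊢
            exact this
          · simp only [h6, h5, h4, if_false]
            exact Nat.zero_le _
    calc 16 * a + 7 * b + 3 * c = ∑ P ∈ flatsQ M 3, (16 * (if (P ∩ X).card = 6 then 1 else 0) +
          7 * (if (P ∩ X).card = 5 then 1 else 0) + 3 * (if (P ∩ X).card = 4 then 1 else 0)) := by
          rw [Finset.sum_add_distrib, Finset.sum_add_distrib, ← Finset.mul_sum, ← Finset.mul_sum,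
            ← Finset.mul_sum, ha, hb, hc, Finset.card_filter, Finset.card_filter, Finset.card_filter]
      _ ≤ ∑ P ∈ flatsQ M 3, (((P ∩ X).powersetCard 3).filter
          (fun T : Finset α => M.eRk (T : Set α) = ((3 : ℕ) : ℕ∞))).card := Finset.sum_le_sum hge
      _ ≤ X.card.choose 3 := sum_planes_rank_three_triples_le hX
  rw [hsum]
  unfold kappa4'
  -- the knapsack is an integer statement (false over `ℚ`): bound `a` and `b` and split
  have ha' : a ≤ 7 := by
    have := Nat.choose_le_choose 3 hs10
    have h10 : Nat.choose 10 3 = 120 := by decide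
    omega
  have hb' : b ≤ 17 := by
    have := Nat.choose_le_choose 3 hs10
    have h10 : Nat.choose 10 3 = 120 := by decide
    omega
  interval_cases h : X.card <;> simp only [Nat.choose] at htr ⊢ <;> norm_num at htr ⊢ <;>
    interval_cases a <;> interval_cases b <;> omega

/-! ## The rank-`4` quadruples of a solid -/

/-- A `4`-subset of `X ⊆ F` (`F` a solid) has rank `3` or `4` when lines have `≤ 3` points. -/
theorem choose_four_le_rank_four_add_three (hs : Simple M) (hline : ∀ L ∈ flatsQ M 2, L.card ≤ 3)
    {F X : Finset α} (hF : F ∈ flatsQ M 4) (hXF : X ⊆ F) :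
    X.card.choose 4 ≤ ((X.powersetCard 4).filter (fun A : Finset α => M.eRk (A : Set α) = ((4 : ℕ) : ℕ∞))).card +
      ((X.powersetCard 4).filter (fun A : Finset α => M.eRk (A : Set α) = ((3 : ℕ) : ℕ∞))).card := by
  have hF' := mem_flatsQ.1 hF
  have hXg : X ⊆ gr M := hXF.trans hF'.1
  rw [← Finset.card_powersetCard]
  rw [← Finset.card_union_of_disjoint (by
    rw [Finset.disjoint_filter]
    intro A _ h1 h2
    rw [h1] at h2
    exact absurd h2 (by decide))]
  apply Finset.card_le_card
  intro A hA
  rw [Finset.mem_union, Finset.mem_filter, Finset.mem_filter]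
  have hA' := Finset.mem_powersetCard.1 hA
  have hr4 : M.eRk (A : Set α) ≤ ((4 : ℕ) : ℕ∞) := by
    rw [← hF'.2.2]
    exact M.eRk_mono (Finset.coe_subset.2 (hA'.1.trans hXF))
  obtain ⟨r, hr⟩ := exists_eRk_eq_nat (M := M) A
  have hr4' : r ≤ 4 := by rw [hr] at hr4; exact_mod_cast hr4
  have hr3 : 3 ≤ r := by
    by_contra hlt
    have hle : M.eRk (A : Set α) ≤ 2 := by
      rw [hr]
      exact_mod_cast (show r ≤ 2 by omega)
    have := card_le_three_of_eRk_le_two' hs hline (hA'.1.trans hXg) hle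
    omega
  rcases (show r = 4 ∨ r = 3 by omega) with h | h
  · exact Or.inl ⟨hA, by rw [hr, h]⟩
  · exact Or.inr ⟨hA, by rw [hr, h]⟩

/-- `κ₄(s) = C(s, 4) − κ₄'(s)` for `s ∈ {7, 8, 9, 10}` (`4, 20, 50, 100`), `0` otherwise. -/
def kappa4 (s : ℕ) : ℕ :=
  if s = 7 then 4 else if s = 8 then 20 else if s = 9 then 50 else if s = 10 then 100 else 0

/-- **`κ₄(|F ∩ G|) ≤ #{A ⊆ F ∩ G : |A| = 4, rk A = 4}`** for a solid `F` (lines `≤ 3`, planes `≤ 6`). -/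
theorem card_rank_four_fours_ge (hs : Simple M) (hline : ∀ L ∈ flatsQ M 2, L.card ≤ 3)
    (hplane : ∀ P ∈ flatsQ M 3, P.card ≤ 6) {G F : Finset α} (hG : G ⊆ gr M) (hF : F ∈ flatsQ M 4) :
    kappa4 (F ∩ G).card ≤
      (((F ∩ G).powersetCard 4).filter (fun A : Finset α => M.eRk (A : Set α) = ((4 : ℕ) : ℕ∞))).card := by
  by_cases hs7 : 7 ≤ (F ∩ G).card ∧ (F ∩ G).card ≤ 10
  · have hXg : F ∩ G ⊆ gr M := Finset.inter_subset_right.trans hG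
    have h1 := choose_four_le_rank_four_add_three hs hline hF (Finset.inter_subset_left (s₂ := G))
    have h2 := card_rank_three_fours_le (M := M) hXg (X := F ∩ G)
    have h3 := sum_planes_choose_four_le hs hline hplane hXg hs7.1 hs7.2
    have h4 : (F ∩ G).card.choose 4 = kappa4' (F ∩ G).card + kappa4 (F ∩ G).card := by
      unfold kappa4' kappa4
      obtain ⟨h7, h10⟩ := hs7
      interval_cases h : (F ∩ G).card <;> decide
    omega
  · have : kappa4 (F ∩ G).card = 0 := by
      unfold kappa4
      have : ¬ (F ∩ G).card = 7 ∧ ¬ (F ∩ G).card = 8 ∧ ¬ (F ∩ G).card = 9 ∧ ¬ (F ∩ G).card = 10 := by omega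
      simp only [this.1, this.2.1, this.2.2.1, this.2.2.2, if_false]
    rw [this]
    exact Nat.zero_le _

/-- Grouping the solids by their number of points of `G`: `Σ_F κ₄(|F ∩ G|) = Σ_s κ₄(s)·N4 s`. -/
theorem sum_solids_kappa4_eq (G : Finset α) :
    ∑ F ∈ flatsQ M 4, kappa4 (F ∩ G).card = ∑ s ∈ Finset.range (G.card + 1), kappa4 s * N4 M G s := by
  rw [← Finset.sum_fiberwise_of_maps_to (s := flatsQ M 4) (t := Finset.range (G.card + 1))
    (g := fun F : Finset α => (F ∩ G).card) (fun F _ => Finset.mem_coe.2 (Finset.mem_range.2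
      (Nat.lt_succ_of_le (Finset.card_le_card Finset.inter_subset_right))))]
  apply Finset.sum_congr rfl
  intro s _
  unfold N4
  rw [Finset.card_eq_sum_ones, Finset.mul_sum]
  apply Finset.sum_congr rfl
  intro F hF
  rw [(Finset.mem_filter.1 hF).2, mul_one]

/-- **THE ROW (S6q) of the `t = 5` trace LP**: `Σ_s κ₄(s)·N4 s ≤ C(|G|, 4)` on a subset `G` of a simple matroid with
lines `≤ 3` and planes `≤ 6` points — each rank-`4` quadruple of `G` lies in exactly one solid, and a solid with `s`
points of `G` carries `≥ κ₄(s)` of them. -/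
theorem sum_solids_kappa4_le (hs : Simple M) (hline : ∀ L ∈ flatsQ M 2, L.card ≤ 3)
    (hplane : ∀ P ∈ flatsQ M 3, P.card ≤ 6) {G : Finset α} (hG : G ⊆ gr M) :
    ∑ s ∈ Finset.range (G.card + 1), kappa4 s * N4 M G s ≤ G.card.choose 4 := by
  rw [← sum_solids_kappa4_eq]
  calc ∑ F ∈ flatsQ M 4, kappa4 (F ∩ G).card
      ≤ ∑ F ∈ flatsQ M 4, (((F ∩ G).powersetCard 4).filter
          (fun A : Finset α => M.eRk (A : Set α) = ((4 : ℕ) : ℕ∞))).card :=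
        Finset.sum_le_sum (fun F hF => card_rank_four_fours_ge hs hline hplane hG hF)
    _ = ((G.powersetCard 4).filter (fun A : Finset α => M.eRk (A : Set α) = ((4 : ℕ) : ℕ∞))).card :=
        (card_rank_eq_eq_sum_flats hG 4 4).symm
    _ ≤ (G.powersetCard 4).card := Finset.card_filter_le _ _
    _ = G.card.choose 4 := Finset.card_powersetCard 4 G

end PercRepro.Night4
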